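import Mathlib.Order.Filter.AtTopBot.Basic
import Literature.Computability.Cryptography.LWE
import Literature.Computability.Cryptography.LWENoise
import HarnessLib

-- provenance: harness21/H21/H21/Statements/PQC/LWE.lean @ 92cfc90 (interim HEAD d8f2665); M5 mechanical rewrite
/-!
# Learning With Errors: definitions and asymptotic glue (family `pqc`, trunk T-LATTICE, G10)

This statement file realises **pqc.S18** (Regev 2009, §2 and §4: the LWE distribution `A_{s,χ}`, the
error distributions `Ψ_α`, `Ψ̄_α`, and the search / decision LWE problems).  The inventory item has
*definition* role; the definitions themselves live in the prelude (`Literature.Computability.Cryptography.LWE.lweSample`,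
`Literature.Computability.Cryptography.LWE.wrappedGaussian`, `Literature.Computability.Cryptography.LWE.discretizedGaussian`, `Literature.Computability.Cryptography.LWE.torusLWESample`,
`Literature.Computability.Cryptography.LWE.searchSuccessProb`, `Literature.Computability.Cryptography.LWE.distinguishingAdvantage`).  Here we

* record the *acceptance theorems* of those definitions specialised to plain LWE
  (`R = ZMod q`, `ι = Fin n`): the first marginal of `A_{s,χ}` is uniform, the law of `b - ⟨a, s⟩` is `χ`,
  `Ψ̄_α` is the discretisation of `Ψ_α`, advantages are at most `1`, uniform noise carries no information
  (`searchSuccessProb = 1/qⁿ`), and the torus distribution `A_{s,φ}` has uniform first marginal;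
* provide the *asymptotic glue* through which the hardness statements (`pqc.S01`, `pqc.S02`,
  `pqc.S19`–`pqc.S22`) quantify over machine classes: `SearchLWESolves`, `DecisionLWEDistinguishes`,
  `NonNegligibleAdvantage`.  These are family-level predicates on sequences of abstract solvers /
  distinguishers (Markov kernels), with no machine model.

## Mathlib

Mathlib has `PMF`, `PMF.map`, `PMF.uniformOfFintype`, `PMF.toMeasure`, `Measure.map`, `dotProduct`,
`Filter.atTop` / `Filter.Eventually`, `ZMod`; all used.  Mathlib has no LWE material and no notion of
negligible / non-negligible function (searched `negligible`, `Negligible`: only measure-theoretic and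
asymptotic `SuperpolynomialDecay` in `Mathlib/Analysis/Asymptotics/SuperpolynomialDecay.lean`, which is the
*negligible* side; we need the inverse-polynomial *lower* bound and state it directly).

## Design (vacuity audit)

Every threshold of the form `1/n^c`, or involving `q n`, sits under `∀ᶠ n in atTop`, never under a bare
`∀ n`: in Lean `1/(0:ℝ)^c = 0` for `c ≠ 0`, so a pointwise version would be trivial or contradictory at
`n = 0`.  The instance binder `[∀ n, NeZero (q n)]` is how consumers obtain `Fintype (ZMod (q n))`
(from `Literature.Computability.Cryptography.LWE.RegevRegime.neZero`).

## References

* O. Regev, *On lattices, learning with errors, random linear codes, and cryptography*, J. ACM 56 (2009),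
  §2 (definitions), §4 (search / decision variants, Lemmas 4.1–4.2).
* C. Peikert, *A decade of lattice cryptography*, Found. Trends TCS 10 (2016), §4.2.
-/

noncomputable section

open MeasureTheory Filter
open scoped ENNReal

namespace Literature.Computability.Cryptography

section PQC

open LWE

/-! ### Acceptance theorems for plain LWE (`R = ZMod q`, `ι = Fin n`) -/

section Plain

variable {n : ℕ} {q : ℕ} [NeZero q]

/-- **pqc.S18** (LWE distribution `A_{s,χ}`; Regev 2009 §2).  The first coordinate of an LWE sample
`(a, ⟨a, s⟩ + e)` over `ℤ_qⁿ` is uniformly distributed on `ℤ_qⁿ`.  Specialisation of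
`Literature.Computability.Cryptography.LWE.lweSample_map_fst`. [cite: Regev2009, §2] -/
def lweSample_fst_uniform : Prop :=
  ∀ (χ : PMF (ZMod q)) (s : Fin n → ZMod q),
    (lweSample χ s).map Prod.fst = PMF.uniformOfFintype (Fin n → ZMod q)

/- interim proof relied on results that are now named facts (D-0014); demoted to a fact by the M5 import, proof preserved:
:=
  lweSample_map_fst χ s
-/

/-- **pqc.S18** (LWE distribution `A_{s,χ}`; Regev 2009 §2).  For a sample `(a, b) ← A_{s,χ}` the error
`b - ⟨a, s⟩` has law exactly `χ`. [cite: Regev2009, §2] -/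
def lweSample_noise_law : Prop :=
  ∀ (χ : PMF (ZMod q)) (s : Fin n → ZMod q),
    (lweSample χ s).map (fun p ↦ p.2 - p.1 ⬝ᵥ s) = χ

/-- **pqc.S18** (`Ψ̄_α` is the discretisation of `Ψ_α`; Regev 2009 §2).  The discretised Gaussian
`Ψ̄_α` on `ℤ_q` is the pushforward of the wrapped Gaussian `Ψ_α` on `𝕋 = ℝ/ℤ` along
`x ↦ ⌊q x⌉ mod q`.  Restatement of `Literature.Computability.Cryptography.LWE.discretizedGaussian_eq_map_wrappedGaussian`. [cite: Regev2009, §2] -/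
theorem discretizedGaussian_eq_map_wrappedGaussian' (q : ℕ) [NeZero q] (α : ℝ) :
    (discretizedGaussian q α).toMeasure = (wrappedGaussian α).map (discretizeCircle q) :=
  discretizedGaussian_eq_map_wrappedGaussian q α

/-- **pqc.S18** (decision LWE; Regev 2009 §4).  The decision-LWE advantage of any distinguisher on
`m` samples over `ℤ_q` is at most `1`.  Specialisation of `Literature.Computability.Cryptography.LWE.distinguishingAdvantage_le_one`. [cite: Regev2009, §4] -/
def distinguishingAdvantage_le_one' : Prop :=
  ∀ (χ : PMF (ZMod q)) (m : ℕ) (D : Distinguisher (Fin n) (ZMod q) m),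
    distinguishingAdvantage χ m D ≤ 1

/- interim proof relied on results that are now named facts (D-0014); demoted to a fact by the M5 import, proof preserved:
:=
  distinguishingAdvantage_le_one χ m D
-/

/-- **pqc.S18** (search LWE; Regev 2009 §4).  Sanity check on the search functional: with *uniform* noise
the samples are independent of the secret, so every solver on `m` samples recovers a uniform secret
`s ∈ ℤ_qⁿ` with probability exactly `1/qⁿ` (no information). [cite: Regev2009, §4] -/
def searchSuccessProb_uniformNoise : Prop :=
  ∀ (m : ℕ) (A : Solver (Fin n) (ZMod q) m),
    searchSuccessProb (PMF.uniformOfFintype (ZMod q)) m A = 1 / (q : ℝ≥0∞) ^ n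

/-- **pqc.S18** (continuous-noise LWE distribution `A_{s,φ}` on `ℤ_qⁿ × 𝕋`; Regev 2009 §2, §4).  For a
probability measure `φ` on the torus, the first marginal of `A_{s,φ}` is the uniform distribution on
`ℤ_qⁿ`.  Meaningful (not a `Measure.map` junk value) because the prelude proves
`Literature.Computability.Cryptography.LWE.measurable_torusSampleMap`. [cite: Regev2009, §2  §4] -/
def torusLWESample_fst : Prop :=
  ∀ (φ : Measure UnitAddCircle) [IsProbabilityMeasure φ] (s : Fin n → ZMod q),
    (torusLWESample q φ s).map Prod.fst = (PMF.uniformOfFintype (Fin n → ZMod q)).toMeasure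

end Plain

/-! ### Asymptotic glue: solving search LWE, distinguishing decision LWE -/

section Asymptotic

variable (q : ℕ → ℕ) [∀ n, NeZero (q n)] (χ : ∀ n, PMF (ZMod (q n))) (m : ℕ → ℕ)

/-- **pqc.S18** (search LWE, asymptotic form; Regev 2009 §4).  The family of solvers `A n` (one for each
dimension `n`, on `m n` samples of `LWE_{q(n), χ(n)}`) *solves search LWE with success probability at least
`p`*: eventually in `n`, `Pr_{s, samples}[A n (samples) = s] ≥ p n`.  Machine classes (classical /
quantum polynomial time) are imposed on `A` by the consuming statements; the threshold sits under
`∀ᶠ n in atTop` (vacuity audit). [cite: Regev2009, §4] -/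
def SearchLWESolves (A : ∀ n, Solver (Fin n) (ZMod (q n)) (m n)) (p : ℕ → ℝ) : Prop :=
  ∀ᶠ n in atTop, ENNReal.ofReal (p n) ≤ searchSuccessProb (χ n) (m n) (A n)

/-- **pqc.S18** (decision LWE, asymptotic form; Regev 2009 §4; Peikert 2016 Def. 4.2.2).  The family of
distinguishers `D n` *distinguishes `LWE_{q(n), χ(n)}` from uniform with advantage at least `adv`*:
eventually in `n`, `|Pr[D n (A_{s,χ}^{m n}) accepts] - Pr[D n (U^{m n}) accepts]| ≥ adv n` (average-case
in the secret `s`).  The threshold sits under `∀ᶠ n in atTop` (vacuity audit). [cite: Regev2009, §4] -/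
def DecisionLWEDistinguishes (D : ∀ n, Distinguisher (Fin n) (ZMod (q n)) (m n)) (adv : ℕ → ℝ) :
    Prop :=
  ∀ᶠ n in atTop, adv n ≤ distinguishingAdvantage (χ n) (m n) (D n)

/-- **pqc.S18** (decision LWE with non-negligible advantage; Regev 2009 §4, Lemma 4.1).  The family of
distinguishers `D n` has *non-negligible* (inverse-polynomial) advantage against `LWE_{q(n), χ(n)}`:
for some `c`, eventually `adv(D n) ≥ 1/n^c`.  (This is the "infinitely often"–free, eventual form used by
the hardness statements; `1/(0:ℝ)^c = 0` is harmless under `∀ᶠ n in atTop`.) [cite: Regev2009, §4  Lemma 4.1] -/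
def NonNegligibleAdvantage (D : ∀ n, Distinguisher (Fin n) (ZMod (q n)) (m n)) : Prop :=
  ∃ c : ℕ, DecisionLWEDistinguishes q χ m D (fun n ↦ 1 / (n : ℝ) ^ c)

variable {q χ m}

/-- Monotonicity of the search predicate in the threshold: solving with probability `≥ p` implies solving
with probability `≥ p'` for any eventually smaller `p'`. [folklore] -/
theorem SearchLWESolves.mono {A : ∀ n, Solver (Fin n) (ZMod (q n)) (m n)} {p p' : ℕ → ℝ}
    (h : SearchLWESolves q χ m A p) (hp : ∀ᶠ n in atTop, p' n ≤ p n) : SearchLWESolves q χ m A p' := by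
  filter_upwards [h, hp] with n hn hpn
  exact (ENNReal.ofReal_le_ofReal hpn).trans hn

/-- Monotonicity of the decision predicate in the threshold. [folklore] -/
theorem DecisionLWEDistinguishes.mono {D : ∀ n, Distinguisher (Fin n) (ZMod (q n)) (m n)}
    {adv adv' : ℕ → ℝ} (h : DecisionLWEDistinguishes q χ m D adv)
    (hadv : ∀ᶠ n in atTop, adv' n ≤ adv n) : DecisionLWEDistinguishes q χ m D adv' := by
  filter_upwards [h, hadv] with n hn han
  exact han.trans hn

/-- Every family of distinguishers distinguishes with advantage `≥ 0` (the predicate is nonvacuous;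
advantages are nonnegative by `Literature.Computability.Cryptography.LWE.distinguishingAdvantage_nonneg`). [folklore] -/
theorem decisionLWEDistinguishes_zero (D : ∀ n, Distinguisher (Fin n) (ZMod (q n)) (m n)) :
    DecisionLWEDistinguishes q χ m D (fun _ ↦ 0) :=
  Eventually.of_forall fun n ↦ distinguishingAdvantage_nonneg (χ n) (m n) (D n)

/-- With uniform noise no family of distinguishers has non-negligible advantage (the advantage is
identically `0` by `Literature.Computability.Cryptography.LWE.distinguishingAdvantage_uniform_eq_zero`, while `1/n^c > 0` for `n ≥ 1`). [cite: RegevLWE2009, §4 (uniform noise: A_{s,U} is uniform, advantage 0); corollary of Literature.LWE.distinguishingAdvantage_uniform_eq_zero, pending proof] -/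
def not_nonNegligibleAdvantage_uniform : Prop :=
  ∀ (D : ∀ n, Distinguisher (Fin n) (ZMod (q n)) (m n)),
    ¬ NonNegligibleAdvantage q (fun n ↦ PMF.uniformOfFintype (ZMod (q n))) m D

end Asymptotic

end PQC

end Literature.Computability.Cryptography

end
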